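import Summits.ABC.IUTFork.Thm311RealInd1StripSignature
import Summits.ABC.IUTFork.Thm311RealInd2IsmRigid
import Summits.ABC.IUTFork.Thm311RealLog
import Literature.AnabelianGeometry.AbsoluteAnabelian.MLFArtinTransport
import Literature.IUT.LogVolume.LocalUnitLogEquivariance
import Mathlib.FieldTheory.IsAlgClosed.Basic
import HarnessLib

/-!
# [IUTchIII] Theorem 3.11 (i) (Ind1), print-literal at `v ∈ 𝕍^non`: NON-VACUITY of the strip part — every
# valuation-preserving automorphism of `K_v` IS a realised strip automorphism (analytic logarithm)

Proof-only record file (D-0012) of the abc-iut cell (seat abc-iut-c312-1, holder of record of the typed [IUTchIII] Thm.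
3.11, gen 8); sequel of `Thm311RealInd1Strip` / `…Signature` / `…DegOne`.  TAKES NO SIDE on [IUTchIII] Cor. 3.12.

VACUITY AUDIT (LANA Rem. 8.2.1 duty) of the gen-8 typing `Real.ind1StripOf v L` of print's (Ind1) strip part.  At a place
of local degree one it is `{1}` (`Thm311RealInd1StripDegOne`).  In general it is NOT trivial: every ring automorphism `γ`
of `K_v` preserving the valuation (e.g. every element of `Gal(K_v/ℚ_p)` when `K_v/ℚ_p` is Galois) extends to a
`γ`-semilinear automorphism `φ` of `K̄_v` (Mathlib `IsAlgClosure.equivOfEquiv`); conjugation by `φ` is a topological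
automorphism `c` of `G_v` (abc-iut-L4's `exists_continuousMulEquiv_semilinear_conj`, `MLFArtinTransport`) — in general an
OUTER one; `φ` restricted to `𝒪^⊳_{K̄_v}` (`map_mem_absIntegers`) is `c`-equivariant, hence IS THE lift `liftM(c)`
(`Genuine.liftM_unique`), so `Real.liftUnits v c` is `γ` on `𝒪_v^×`; and abc-iut-S1's analytic logarithm commutes with
norm-preserving ring isomorphisms (abc-iut-w5-d242's `unitLog_map_ringEquiv`, [IUTchIII] Prop. 1.2 (ii) «Galois-equivariance
of the power series defining the `p_v`-adic logarithm»).  Hence: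

* `Real.exists_liftUnits_coe_eq_of_valPreserving` — `∃ c : Gal v ≃ₜ* Gal v, ∀ u, liftUnits v c u = γ u` (in `K_v`);
* `Real.mem_ind1StripOf_of_valPreserving` — for every `γ`-equivariant logarithm `L`, `γ ∈ Real.ind1StripOf v L`
  (given bicontinuity of `γ`, print's "ind-topological");
* `Real.analyticLogv_coe_eq_of_valPreserving` — abc-iut-c312-5's canonical `Real.analyticLogv F v` IS `γ`-equivariant;
* **`Real.mem_ind1StripOf_analyticLogv_of_valPreserving`** / **`Real.exists_mem_ind1Strip_analyticLogv_of_valPreserving`** —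
  `γ ∈ Real.ind1StripOf v (analyticLogv F v)`, resp. (as a `ℚ`-linear automorphism of the carrier)
  `∈ Real.ind1Strip (analyticLogv F) v`: print's (Ind1) strip slot STRICTLY CONTAINS Dupuy–Hilado's `stripAutDH = {1}` as soon
  as `K_v` has a non-trivial bicontinuous valuation-preserving automorphism — while still lying inside DH's (Ind2) group
  `Aut_{ℚ_p}(K_v : I_v)` (`Real.ind1Strip_subset_ismDH`), so the sandwich `Real.indGroup_print_le_DH` is where it matters.

HONEST SCOPE: the continuity of `γ`, `γ⁻¹` and the valuation-preservation are hypotheses (for `σ ∈ Gal(K_v/ℚ_p)` all three are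
classical; not re-derived here); nothing here asserts or refutes [IUTchIII] Cor. 3.12; no side taken.
[claim: Mochizuki2012, status: disputed] for the quotations; [cite: MochizukiAbsTopIII2015, Proposition 3.2 (iv) p.72];
[cite: NeukirchANT1999, Ch. II Prop. (5.5)]. typed ≠ proved elsewhere; instantiated ≠ endorsed.
-/

set_option autoImplicit false

noncomputable section

namespace Summit.ABC.IUTFork.Thm311.Real

open NumberField IsDedekindDomain Literature.IUT.LogVolume Literature.IUT.LogThetaLattice
open Literature.AnabelianGeometry.AbsoluteAnabelian Literature.IUT.HodgeArakelov
open Literature.IUT.HodgeArakelov.AbsTopMonoids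
open Literature.NumberTheory.GaloisRepresentations Literature.NumberTheory.NumberFields

variable {F : Type} [Field F] [NumberField F] (v : HeightOneSpectrum (𝓞 F))

/-! ## 1. A valuation-preserving `γ ∈ Aut(K_v)` extends to `K̄_v` and conjugates `G_v` -/

section Extend

variable {γ : v.adicCompletion F ≃+* v.adicCompletion F}

/-- A ring automorphism `γ` of `K_v` extends to a `γ`-semilinear ring automorphism `φ` of `K̄_v`
(`φ ∘ ι = ι ∘ γ`; Mathlib `IsAlgClosure.equivOfEquiv`). [folklore] -/
theorem exists_semilinear_extension (γ : v.adicCompletion F ≃+* v.adicCompletion F) :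
    ∃ φ : AlgebraicClosure (v.adicCompletion F) ≃+* AlgebraicClosure (v.adicCompletion F),
      ∀ x, φ (algebraMap (v.adicCompletion F) (AlgebraicClosure (v.adicCompletion F)) x) =
        algebraMap (v.adicCompletion F) (AlgebraicClosure (v.adicCompletion F)) (γ x) :=
  ⟨IsAlgClosure.equivOfEquiv (AlgebraicClosure (v.adicCompletion F)) (AlgebraicClosure (v.adicCompletion F)) γ,
    IsAlgClosure.equivOfEquiv_algebraMap _ _ γ⟩

/-- If `γ` preserves the valuation, so does `γ⁻¹`. [folklore] -/
theorem valPreserving_symm (hγ : ∀ x, ValuativeRel.valuation (v.adicCompletion F) (γ x) =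
      ValuativeRel.valuation (v.adicCompletion F) x) (x : v.adicCompletion F) :
    ValuativeRel.valuation (v.adicCompletion F) (γ.symm x) = ValuativeRel.valuation (v.adicCompletion F) x := by
  conv_rhs => rw [← γ.apply_symm_apply x]
  rw [hγ]

/-- The inverse of a `γ`-semilinear `φ` is `γ⁻¹`-semilinear. [folklore] -/
theorem symm_semilinear' {φ : AlgebraicClosure (v.adicCompletion F) ≃+* AlgebraicClosure (v.adicCompletion F)}
    (hφ : ∀ x, φ (algebraMap (v.adicCompletion F) (AlgebraicClosure (v.adicCompletion F)) x) =
      algebraMap (v.adicCompletion F) (AlgebraicClosure (v.adicCompletion F)) (γ x)) (x : v.adicCompletion F) :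
    φ.symm (algebraMap (v.adicCompletion F) (AlgebraicClosure (v.adicCompletion F)) x) =
      algebraMap (v.adicCompletion F) (AlgebraicClosure (v.adicCompletion F)) (γ.symm x) := by
  apply φ.injective
  rw [φ.apply_symm_apply, hφ, γ.apply_symm_apply]

/-- **A valuation-preserving `γ ∈ Aut(K_v)` IS a strip automorphism on `𝒪_v^×`**: there is a topological automorphism
`c` of `G_v` (conjugation by a semilinear extension `φ` of `γ` to `K̄_v` — abc-iut-L4's
`exists_continuousMulEquiv_semilinear_conj`) whose lift `liftUnits v c` acts on `𝒪_v^×` as `γ`: THE `c`-equivariant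
automorphism of `𝒪^⊳_{K̄_v}` is `φ` itself (`map_mem_absIntegers` + `Genuine.liftM_unique`).
[cite: MochizukiAbsTopIII2015, Proposition 3.2 (iv) p.72] -/
theorem exists_liftUnits_coe_eq_of_valPreserving
    (hγ : ∀ x, ValuativeRel.valuation (v.adicCompletion F) (γ x) = ValuativeRel.valuation (v.adicCompletion F) x) :
    ∃ c : Gal v ≃ₜ* Gal v, ∀ u : (↥(v.adicCompletionIntegers F))ˣ,
      ((liftUnits v c u : ↥(v.adicCompletionIntegers F)) : v.adicCompletion F) =
        γ ((u : ↥(v.adicCompletionIntegers F)) : v.adicCompletion F) := by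
  obtain ⟨φ, hφ⟩ := exists_semilinear_extension v γ
  have hφ' := symm_semilinear' v hφ
  have hγ' := valPreserving_symm v hγ
  obtain ⟨c, hc⟩ := exists_continuousMulEquiv_semilinear_conj φ hφ
  -- `φ` and `φ⁻¹` preserve `𝒪^⊳_{K̄_v}`
  have hS : ∀ y ∈ nonzeroIntegers (v.adicCompletion F) (AlgebraicClosure (v.adicCompletion F)),
      φ y ∈ nonzeroIntegers (v.adicCompletion F) (AlgebraicClosure (v.adicCompletion F)) := fun y hy =>
    ⟨map_mem_absIntegers hγ hφ hy.1, (map_ne_zero φ).mpr hy.2⟩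
  have hS' : ∀ y ∈ nonzeroIntegers (v.adicCompletion F) (AlgebraicClosure (v.adicCompletion F)),
      φ.symm y ∈ nonzeroIntegers (v.adicCompletion F) (AlgebraicClosure (v.adicCompletion F)) := fun y hy =>
    ⟨map_mem_absIntegers hγ' hφ' hy.1, (map_ne_zero φ.symm).mpr hy.2⟩
  -- `φ` restricted to `𝒪^⊳`
  let Φ : nonzeroIntegers (v.adicCompletion F) (AlgebraicClosure (v.adicCompletion F)) ≃*
      nonzeroIntegers (v.adicCompletion F) (AlgebraicClosure (v.adicCompletion F)) :=
    { toFun := fun x => ⟨φ x, hS _ x.2⟩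
      invFun := fun y => ⟨φ.symm y, hS' _ y.2⟩
      left_inv := fun x => Subtype.ext (φ.symm_apply_apply (x : AlgebraicClosure (v.adicCompletion F)))
      right_inv := fun y => Subtype.ext (φ.apply_symm_apply (y : AlgebraicClosure (v.adicCompletion F)))
      map_mul' := fun x y => Subtype.ext (map_mul φ _ _) }
  have hΦ : ∀ x : nonzeroIntegers (v.adicCompletion F) (AlgebraicClosure (v.adicCompletion F)),
      ((Φ x : nonzeroIntegers (v.adicCompletion F) (AlgebraicClosure (v.adicCompletion F))) :
        AlgebraicClosure (v.adicCompletion F)) = φ x := fun _ => rfl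
  -- `Φ` is `c`-equivariant, hence THE lift of `c`
  have hlift : Φ = Genuine.liftM (closureAt v) c := by
    refine Genuine.liftM_unique (closureAt v) c Φ fun (σ : Gal v) x => ?_
    apply Subtype.ext
    change φ (σ • ((x : nonzeroIntegers (v.adicCompletion F) (AlgebraicClosure (v.adicCompletion F))) :
        AlgebraicClosure (v.adicCompletion F))) =
      c σ • φ ((x : nonzeroIntegers (v.adicCompletion F) (AlgebraicClosure (v.adicCompletion F))) :
        AlgebraicClosure (v.adicCompletion F))
    exact (hc σ _).symm
  refine ⟨c, fun u => ?_⟩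
  -- read `stripLift c (u) = liftUnits c u` in `K̄_v`
  have h1 := congrArg (val v) (stripLift_toOUnits v c u)
  rw [val_toOUnits] at h1
  have h2 : val v (stripLift v c (toOUnits v u)) = φ (val v (toOUnits v u)) := by
    change (((stripLift v c (toOUnits v u) : OUnits v) :
        nonzeroIntegers (v.adicCompletion F) (AlgebraicClosure (v.adicCompletion F))) :
      AlgebraicClosure (v.adicCompletion F)) = φ _
    rw [coe_stripLift, ← hlift, hΦ]
  rw [val_toOUnits, hφ] at h2
  rw [h2] at h1
  exact ((algebraMap (v.adicCompletion F) (AlgebraicClosure (v.adicCompletion F))).injective h1).symm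

end Extend

/-! ## 2. Realisation through a `γ`-equivariant logarithm -/

section Realise

variable {γ : v.adicCompletion F ≃+* v.adicCompletion F}

/-- **`γ` lies in print's (Ind1) strip part** for every logarithm `L` that is `γ`-EQUIVARIANT on `𝒪_v^×`
(`L u' = γ (L u)` whenever `u' = γ u`), given that `γ` preserves the valuation and is bicontinuous.
[claim: Mochizuki2012, status: disputed] -/
theorem mem_ind1StripOf_of_valPreserving (L : Additive (↥(v.adicCompletionIntegers F))ˣ →+ v.adicCompletion F)
    (hγ : ∀ x, ValuativeRel.valuation (v.adicCompletion F) (γ x) = ValuativeRel.valuation (v.adicCompletion F) x)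
    (hγc : Continuous γ) (hγc' : Continuous γ.symm)
    (hL : ∀ u u' : (↥(v.adicCompletionIntegers F))ˣ,
      ((u' : ↥(v.adicCompletionIntegers F)) : v.adicCompletion F) =
        γ ((u : ↥(v.adicCompletionIntegers F)) : v.adicCompletion F) →
      L (Additive.ofMul u') = γ (L (Additive.ofMul u))) :
    γ.toAddEquiv ∈ ind1StripOf v L := by
  obtain ⟨c, hcu⟩ := exists_liftUnits_coe_eq_of_valPreserving v hγ
  refine ⟨hγc, hγc', c, ?_⟩
  rw [realises_stripMulAut_iff]
  intro u
  exact (hL u (liftUnits v c u) (hcu u)).symm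

end Realise

/-! ## 3. The analytic logarithm is `γ`-equivariant -/

section Analytic

variable (F)
variable {γ : v.adicCompletion F ≃+* v.adicCompletion F}

/-- A valuation-preserving `γ` preserves Mathlib's valuation `Valued.v` of `K_v` (the two valuations are equivalent).
[folklore] -/
theorem valued_eq_of_valPreserving
    (hγ : ∀ x, ValuativeRel.valuation (v.adicCompletion F) (γ x) = ValuativeRel.valuation (v.adicCompletion F) x)
    (x : v.adicCompletion F) : Valued.v (γ x) = Valued.v x := by
  have hE := ValuativeRel.isEquiv (ValuativeRel.valuation (v.adicCompletion F))
    (Valued.v : Valuation (v.adicCompletion F) (WithZero (Multiplicative ℤ)))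
  apply le_antisymm
  · exact (hE (γ x) x).mp (hγ x).le
  · exact (hE x (γ x)).mp (hγ x).ge

/-- **abc-iut-c312-5's analytic logarithm is `γ`-equivariant** for a valuation-preserving `γ`: read in abc-iut-S7's rescaled
completion (a normed `ℚ_p`-algebra on the same type) `γ` is norm-preserving, and abc-iut-S1's `unitLog` commutes with
norm-preserving ring isomorphisms (abc-iut-w5-d242's `unitLog_map_ringEquiv`, [IUTchIII] Prop. 1.2 (ii)).
[cite: NeukirchANT1999, Ch. II Prop. (5.5)] -/
theorem analyticLogv_coe_eq_of_valPreserving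
    (hγ : ∀ x, ValuativeRel.valuation (v.adicCompletion F) (γ x) = ValuativeRel.valuation (v.adicCompletion F) x)
    (u u' : (↥(v.adicCompletionIntegers F))ˣ)
    (h : ((u' : ↥(v.adicCompletionIntegers F)) : v.adicCompletion F) =
      γ ((u : ↥(v.adicCompletionIntegers F)) : v.adicCompletion F)) :
    analyticLogv F v (Additive.ofMul u') = γ (analyticLogv F v (Additive.ofMul u)) := by
  haveI : Fact (residueChar F v).Prime := ⟨residueChar_prime F v⟩
  have hv := natCast_residueChar_mem F v
  set K := RescaledCompletion F (residueChar F v) v hv with hK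
  let e : v.adicCompletion F ≃+* K := RescaledCompletion.of F (residueChar F v) v hv
  -- `γ` read on `K` is norm-preserving
  let γ' : K ≃+* K := e.symm.trans (γ.trans e)
  have hγ'e : ∀ x, γ' (e x) = e (γ x) := fun x => by
    change e (γ (e.symm (e x))) = e (γ x)
    rw [RingEquiv.symm_apply_apply]
  have hγ'n : ∀ y : K, ‖γ' y‖ = ‖y‖ := fun y => by
    obtain ⟨x, rfl⟩ := e.surjective y
    have hval : Valued.v (e (γ x)) = Valued.v (e x) := valued_eq_of_valPreserving F v hγ x
    rw [hγ'e, RescaledCompletion.norm_def, RescaledCompletion.norm_def, hval]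
  rw [analyticLogv_apply, analyticLogv_apply, h]
  change e.symm (unitLog (e (γ _))) = γ (e.symm (unitLog (e _)))
  rw [← hγ'e, unitLog_map_ringEquiv (residueChar F v) γ' hγ'n]
  change e.symm (e (γ (e.symm (unitLog (e _))))) = _
  rw [RingEquiv.symm_apply_apply]

/-- **NON-VACUITY of print's (Ind1) strip part, canonical binder**: every bicontinuous valuation-preserving ring
automorphism `γ` of `K_v` lies in `Real.ind1StripOf v (analyticLogv F v)`. [claim: Mochizuki2012, status: disputed] -/
theorem mem_ind1StripOf_analyticLogv_of_valPreserving
    (hγ : ∀ x, ValuativeRel.valuation (v.adicCompletion F) (γ x) = ValuativeRel.valuation (v.adicCompletion F) x)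
    (hγc : Continuous γ) (hγc' : Continuous γ.symm) :
    γ.toAddEquiv ∈ ind1StripOf v (analyticLogv F v) :=
  mem_ind1StripOf_of_valPreserving v (analyticLogv F v) hγ hγc hγc' (analyticLogv_coe_eq_of_valPreserving F v hγ)

/-- The same on abc-iut-c312-5's real signature: `γ`, read as a `ℚ`-linear automorphism of the carrier `K_v` (additive maps
of `ℚ`-vector spaces are `ℚ`-linear), lies in print's (Ind1) strip slot `Real.ind1Strip (analyticLogv F) v` (and there in
DH's `ismDH`, `Real.ind1Strip_subset_ismDH`). [claim: Mochizuki2012, status: disputed] -/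
theorem exists_mem_ind1Strip_analyticLogv_of_valPreserving
    (hγ : ∀ x, ValuativeRel.valuation (v.adicCompletion F) (γ x) = ValuativeRel.valuation (v.adicCompletion F) x)
    (hγc : Continuous γ) (hγc' : Continuous γ.symm) :
    ∃ ψ ∈ ind1Strip (analyticLogv F) v, ∀ x : Carrier (.inr v : Place F), ψ x = γ x := by
  let e' : Carrier (.inr v : Place F) ≃+ Carrier (.inr v : Place F) := γ.toAddEquiv
  refine ⟨e'.toLinearEquiv fun c x => map_rat_smul e' c x, ?_, fun _ => rfl⟩
  exact mem_ind1StripOf_analyticLogv_of_valPreserving F v hγ hγc hγc'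

/-- **Print's strip slot is NOT Dupuy–Hilado's trivialised one at `v`** as soon as `K_v` has a bicontinuous
valuation-preserving ring automorphism `γ ≠ 1`. [cite: DupuyHilado2025, §4.7] [claim: Mochizuki2012, status: disputed] -/
theorem ind1Strip_ne_stripAutDH_of_valPreserving
    (hγ : ∀ x, ValuativeRel.valuation (v.adicCompletion F) (γ x) = ValuativeRel.valuation (v.adicCompletion F) x)
    (hγc : Continuous γ) (hγc' : Continuous γ.symm) (hne : γ ≠ RingEquiv.refl _) :
    ind1Strip (analyticLogv F) v ≠ stripAutDH (.inr v : Place F) := by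
  intro h
  obtain ⟨ψ, hmem, hψ⟩ := exists_mem_ind1Strip_analyticLogv_of_valPreserving F v hγ hγc hγc'
  rw [h] at hmem
  apply hne
  apply RingEquiv.ext
  intro x
  rw [← hψ x, show ψ = LinearEquiv.refl ℚ _ from hmem]
  rfl

end Analytic

end Summit.ABC.IUTFork.Thm311.Real

end
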